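import Summits.Ventures.CertifiedArithmetic.LowPrec.SROptimalBudget
import Literature.ComputerArithmetic.XiaEtAl2022.BiasedSR
import HarnessLib

/-!
# Stochastic rounding in low-precision formats LVIII — the biased schemes `SR_ε` / signed-`SR_ε`
# of Xia–Massei–Hochstenbach–Koren ARE limited-randomness SR steps: dictionary, exact bias,
# n-step envelope, mean-square error and the half-cell optimality criterion

HONEST FRAMING: certified error envelopes and provably optimal rounding/accumulation schemes for
low-precision formats under stated cost models; every table by two implementations; no hardware or
vendor claims.

`Literature/ComputerArithmetic/XiaEtAl2022/BiasedSR` types Def. 2–3 and eqs. (3)–(4) of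
[XiaEtAl2022] verbatim: `SR_ε(x)` rounds to `⌊x⌋` with probability `φ(1 − q(x) − sign(x)ε)` (`q` the
exact-SR up-probability, `φ` clipping to `[0,1]`), i.e. it spends a bias of (at most) `ε(⌈x⌉ − ⌊x⌋)`
AWAY FROM ZERO; signed-`SR_ε` spends it in the direction `−sign(v)`.  This file places both schemes
inside the venture's framework and reads off everything the framework knows:

1. DICTIONARY (`srEpsE_eq_stepQ`): for `c` in the hull of a value set `F ∋ 0`,
   `E f(SR_ε(c)) = stepQ F q_ε c f` with the away-probability function `q_ε(θ) = min(1, θ + ε)`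
   (`qAway`) of file VII/XIX (`LowPrec/SRLimitedBits`: a saturating step whose probability of
   rounding AWAY from zero is `q(θ)`, `θ` the exact away-probability).  `q_ε` maps `[0,1]` into
   `[0,1]`, deviates from the identity by `≤ ε` and lies above it (`qAway_mem`, `qAway_dev`,
   `le_qAway`) — the mirror image of the P3109 `StochasticA` floor rule, which lies below.
2. EXACT BIAS (`stepQ_qAway_bias`): on the nonnegative side `E SR_ε(c) − c = min(⌈c⌉ − c, ε(⌈c⌉ − ⌊c⌋))`
   — eq. (3) of the source without case distinction; n-STEP ENVELOPE (`accExpQ_qAway_bias_le`): for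
   recursive summation with every addition rounded by `SR_ε`, no saturation and gaps `≤ G`,
   `|E ŝ_n − s_n| ≤ n·ε·G` (file XIX's theorem instantiated; exact SR: `0`).
3. MEAN-SQUARE ERROR and OPTIMALITY.  Any two-point law on the cell of `c` with up-probability
   `π ∈ [0,1]` has `MSE = v_F(c) + bias·(⌊c⌋ + ⌈c⌉ − 2c)` (file LV) and is MSE-optimal among ALL
   randomised roundings with the same `|bias|` iff `bias·(⌊c⌋ + ⌈c⌉ − 2c) ≤ 0` (file LVII,
   `twoPoint_budget_iff` here).  Since the bias of `SR_ε(c)` has the sign of `c` and is nonzero off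
   the grid (`sgn_mul_srEps_bias_pos`), **`SR_ε(c)` is MSE-optimal for the bias it spends iff `|c|`
   lies in the UPPER half of its cell** (`srEps_optimal_iff`: `0 ≤ sign(c)·(2c − ⌊c⌋ − ⌈c⌉)`); on the
   lower half the same `|bias|` spent toward zero would be strictly better.  Likewise **signed-`SR_ε`
   (bias of sign `−sign v`) is optimal for its bias iff `0 ≤ sign(v)·(⌊c⌋ + ⌈c⌉ − 2c)`**, i.e. iff `c`
   lies in the half-cell on the side it is pushed to (`signedSrEps_optimal_iff`).  For the source's
   use (gradient descent with the bias in the descent direction) this says: the extra bias is free —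
   costs no mean-square error beyond the optimum for that bias — exactly when the exact update
   already lies past the midpoint of its cell in the descent direction.
4. FP4 witness (kernel, `FP4.e2m1_srEps_witness`): E2M1, `ε = 1/4`, cell `[1, 3/2]`: at `c = 9/8`
   (lower half) `SR_ε` has down-probability `1/2`, bias `1/8`, MSE `5/64` against the optimum `1/64`
   for that bias; at `c = 11/8` (upper half) it rounds up surely, bias `1/8`, MSE `1/64` = the optimum.
Certificates: `certs/sr/gen12/xia/` (A: this dictionary; B: the source's definitions literally).

PRIOR ART for the frontier / budget theorems of files LV and LVII (found after they landed; recorded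
here and in the paper): [XiaEtAl2020, §4, (4.1)–(4.7)] POSE the pointwise bias–variance trade-off of a
two-point randomised rounding (variance `δ²p(1−p)`, bias `B(p)`, constraints `V ≤ V_max`,
`|B| ≤ B_max`) as a multi-objective optimisation problem and solve a penalised scalarisation
NUMERICALLY (particle-swarm optimisation; their distributions D1, D2).  File LVII is the closed-form
solution of the constrained-bias instance (§4.2.4 there; for a fixed mean, variance and MSE differ by
the constant `B²`), proved over all laws on any finite `F`; the problem itself is theirs.
-/

namespace Summit.Ventures.CertifiedArithmetic.LowPrec.SR

open Literature.ComputerArithmetic.ConnollyHighamMary2021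
open Literature.ComputerArithmetic.XiaEtAl2022
open Finset

section Generic

variable {K : Type*} [Field K] [LinearOrder K] [IsStrictOrderedRing K]

/-! ### The away-probability function of `SR_ε` -/

/-- `q_ε(θ) = min(1, θ + ε)`: probability of rounding AWAY from zero under `SR_ε`, as a function of
the exact away-probability `θ`. -/
def qAway (ε θ : K) : K := min 1 (θ + ε)

/-- `q_ε` maps `[0,1]` into `[0,1]` (`0 ≤ ε`). -/
theorem qAway_mem {ε : K} (hε : 0 ≤ ε) :
    ∀ θ : K, 0 ≤ θ → θ ≤ 1 → 0 ≤ qAway ε θ ∧ qAway ε θ ≤ 1 := by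
  intro θ h0 _
  exact ⟨le_min zero_le_one (by linarith), min_le_left _ _⟩

/-- `|q_ε(θ) − θ| ≤ ε` on `[0,1]` (`0 ≤ ε`). -/
theorem qAway_dev {ε : K} (hε : 0 ≤ ε) : ∀ θ : K, 0 ≤ θ → θ ≤ 1 → |qAway ε θ - θ| ≤ ε := by
  intro θ _ h1
  unfold qAway
  rw [abs_le]
  constructor
  · rcases min_choice (1 : K) (θ + ε) with h | h <;> rw [h] <;> linarith
  · linarith [min_le_right (1 : K) (θ + ε)]

/-- `q_ε` lies above the identity on `[0,1]`: `SR_ε` is biased AWAY from zero (`0 ≤ ε`). -/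
theorem le_qAway {ε θ : K} (hε : 0 ≤ ε) (h1 : θ ≤ 1) : θ ≤ qAway ε θ :=
  le_min h1 (by linarith)

/-! ### Two-point laws on a cell as `stepQ` with a constant probability function -/

/-- The constant away-probability function realising up-probability `π` at `c`. -/
def constQ (F : Finset K) (c π : K) : K → K :=
  if 0 ≤ dn F c then fun _ => π else fun _ => 1 - π

omit [IsStrictOrderedRing K] in
/-- Its up-probability is `π`. -/
theorem pUpQ_constQ (F : Finset K) (c π : K) : LimitedBits.pUpQ F (constQ F c π) c = π := by
  unfold LimitedBits.pUpQ constQ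
  split_ifs <;> ring

omit [IsStrictOrderedRing K] in
/-- The two-point law `⌈c⌉` w.p. `π`, `⌊c⌋` w.p. `1 − π` is `stepQ F (constQ F c π) c`. -/
theorem stepQ_constQ (F : Finset K) (c π : K) (f : K → K) :
    LimitedBits.stepQ F (constQ F c π) c f = π * f (up F c) + (1 - π) * f (dn F c) := by
  unfold LimitedBits.stepQ; rw [pUpQ_constQ]

/-- **Optimality criterion for a two-point cell law** (file LVII made explicit): with up-probability
`π ∈ [0,1]` and bias `β = π⌈c⌉ + (1−π)⌊c⌋ − c`, the law attains the least MSE among ALL randomised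
roundings into `F` with `|bias| ≤ |β|` iff `β·(⌊c⌋ + ⌈c⌉ − 2c) ≤ 0`. -/
theorem twoPoint_budget_iff {F : Finset K} {c : K} (hc : InHull F c) {π : K} (h0 : 0 ≤ π)
    (h1 : π ≤ 1) :
    π * (up F c - c) ^ 2 + (1 - π) * (dn F c - c) ^ 2
        = budgetMSE F c |π * up F c + (1 - π) * dn F c - c|
      ↔ (π * up F c + (1 - π) * dn F c - c) * (dn F c + up F c - 2 * c) ≤ 0 := by
  have h := stepQ_sq_eq_budget_iff F (constQ F c π) hc (by rw [pUpQ_constQ]; exact h0)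
    (by rw [pUpQ_constQ]; exact h1)
  simpa only [stepQ_constQ] using h

/-- Sign version: if the bias `β` satisfies `0 < s·β` for a sign `s` with `s·s = 1`, the criterion reads
`s·(⌊c⌋ + ⌈c⌉ − 2c) ≤ 0`. -/
theorem mul_nonpos_iff_of_sign {s β e : K} (hs : s * s = 1) (hβ : 0 < s * β) :
    β * e ≤ 0 ↔ s * e ≤ 0 := by
  have hβ' : β = s * (s * β) := by rw [← mul_assoc, hs, one_mul]
  constructor
  · intro h
    have : s * e * (s * β) ≤ 0 := by
      calc s * e * (s * β) = (s * s) * (β * e) := by ring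
        _ = β * e := by rw [hs, one_mul]
        _ ≤ 0 := h
    by_contra hne
    push Not at hne
    have := mul_pos hne hβ
    linarith
  · intro h
    rw [hβ']
    have : s * (s * β) * e = (s * e) * (s * β) := by ring
    rw [this]
    exact mul_nonpos_of_nonpos_of_nonneg h hβ.le

/-! ### The dictionary -/

omit [IsStrictOrderedRing K] in
/-- In the hull, the venture's candidates and up-probability are the literature's. -/
theorem dn_up_pUp_of_inHull {F : Finset K} {c : K} (hc : InHull F c) :
    dn F c = roundDown F c ∧ up F c = roundUp F c ∧ pUp F c = probUp F c := by
  simp [dn, up, pUp, clamp_eq_self hc]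

omit [IsStrictOrderedRing K] in
/-- Off the grid (`⌊c⌋ < ⌈c⌉`) a hull point is nonzero when `0 ∈ F`, and its sign is decided by the
side of the cell: `0 ≤ ⌊c⌋ ⇒ 0 < c`, `⌊c⌋ < 0 ⇒ c < 0`. -/
theorem sign_of_cell {F : Finset K} {c : K} (hc : InHull F c) (h0 : (0 : K) ∈ F)
    (hdu : dn F c < up F c) : (0 ≤ dn F c → 0 < c) ∧ (dn F c < 0 → c < 0) := by
  obtain ⟨hd, hu, _⟩ := dn_up_pUp_of_inHull hc
  have hcF : c ∉ F := by
    intro hcm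
    rw [hd, hu, roundDown_eq_self_of_mem hcm, roundUp_eq_self_of_mem hcm] at hdu
    exact lt_irrefl _ hdu
  have hc0 : c ≠ 0 := fun h => hcF (h ▸ h0)
  have hdc := dn_le_of_inHull hc
  have hcu := le_up_of_inHull hc
  constructor
  · intro hd0
    exact lt_of_le_of_ne (hd0.trans hdc) (Ne.symm hc0)
  · intro hdn
    rcases mem_le_dn_or_up_le (c := c) h0 with h | h
    · exact absurd hdn (not_lt.mpr h)
    · exact lt_of_le_of_ne (hcu.trans h) hc0

/-- **Dictionary.** For `c` in the hull of a value set containing `0` and `0 ≤ ε`: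
`E f(SR_ε(c)) = stepQ F q_ε c f` — `SR_ε` is the limited-randomness step of file VII whose probability
of rounding away from zero is `q_ε(θ) = min(1, θ + ε)`. -/
theorem srEpsE_eq_stepQ {F : Finset K} {ε c : K} (hε : 0 ≤ ε) (hc : InHull F c) (h0 : (0 : K) ∈ F)
    (f : K → K) : srEpsE F ε c f = LimitedBits.stepQ F (qAway ε) c f := by
  obtain ⟨hd, hu, hp⟩ := dn_up_pUp_of_inHull hc
  have hθ0 := pUp_nonneg F c
  have hθ1 := pUp_le_one F c
  unfold srEpsE LimitedBits.stepQ LimitedBits.pUpQ pEps eta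
  rw [← hd, ← hu, ← hp]
  rcases eq_or_lt_of_le (LimitedBits.dn_le_up F c) with hdu | hdu
  · rw [hdu]; ring
  obtain ⟨spos, sneg⟩ := sign_of_cell hc h0 hdu
  by_cases hd0 : 0 ≤ dn F c
  · have hcpos := spos hd0
    rw [if_pos hd0, show sgn c = 1 by simp [sgn, hcpos], one_mul]
    unfold clip01 qAway
    by_cases h : pUp F c + ε ≤ 1
    · rw [min_eq_left (by linarith : 1 - pUp F c - ε ≤ 1), max_eq_right (by linarith),
        min_eq_right h]
      ring
    · push Not at h
      rw [min_eq_left (by linarith : 1 - pUp F c - ε ≤ 1), max_eq_left (by linarith),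
        min_eq_left h.le]
      ring
  · push Not at hd0
    have hcneg := sneg hd0
    rw [if_neg (not_le.mpr hd0),
      show sgn c = -1 by simp [sgn, hcneg, not_lt.mpr hcneg.le]]
    unfold clip01 qAway
    rw [max_eq_right (le_min (by linarith) zero_le_one), min_comm (1 : K)]
    ring

/-! ### Exact bias and the n-step envelope -/

/-- **Exact bias of `SR_ε` on the nonnegative side**: `E SR_ε(c) − c = min(⌈c⌉ − c, ε(⌈c⌉ − ⌊c⌋))`
(hull point, `0 ≤ ⌊c⌋`, any `ε`) — eq. (3) of the source in closed form. -/
theorem stepQ_qAway_bias {F : Finset K} (ε : K) {c : K} (hc : InHull F c)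
    (hd0 : 0 ≤ dn F c) :
    LimitedBits.stepQ F (qAway ε) c (fun z => z) - c
      = min (up F c - c) (ε * (up F c - dn F c)) := by
  have h := LimitedBits.stepQ_id_sub F (qAway ε) c
  rw [clamp_eq_self hc] at h
  rw [h]
  unfold LimitedBits.pUpQ qAway
  rw [if_pos hd0]
  have hgap : 0 ≤ up F c - dn F c := sub_nonneg.mpr (LimitedBits.dn_le_up F c)
  have hid : (1 - pUp F c) * (up F c - dn F c) = up F c - c := by
    obtain ⟨hd, hu, hp⟩ := dn_up_pUp_of_inHull hc
    have := srMean_eq_self F c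
    unfold srMean at this
    rw [hd, hu, hp]; linear_combination -this
  have hmin : min 1 (pUp F c + ε) - pUp F c = min (1 - pUp F c) ε := by
    rcases le_total (1 : K) (pUp F c + ε) with h1 | h1
    · rw [min_eq_left h1, min_eq_left (by linarith)]
    · rw [min_eq_right h1, min_eq_right (by linarith)]; ring
  rw [hmin, min_mul_of_nonneg _ _ hgap, hid]

/-- **n-step bias envelope for recursive summation under `SR_ε`**: no saturation, gaps `≤ G` ⇒
`|E ŝ_n − (s + ∑ x_i)| ≤ n·ε·G` (file XIX's `abs_accExpQ_id_sub_le` for `q_ε`). -/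
theorem accExpQ_qAway_bias_le (F : Finset K) {ε G : K} (hε : 0 ≤ ε) (x : ℕ → K) (n : ℕ) (s : K)
    (hns : NoSat F x n s) (hg : GapLE F G x n s) :
    |LimitedBits.accExpQ F (qAway ε) x n (fun t => t) s - (s + ∑ i ∈ range n, x i)|
      ≤ n * (ε * G) :=
  LimitedBits.abs_accExpQ_id_sub_le F (qAway_mem hε) (qAway_dev hε) x n s hns hg

/-! ### Mean-square error and the half-cell optimality criterion -/

/-- `SR_ε` lies on the bias–MSE frontier of file LV:
`E(SR_ε(c) − c)² = v_F(c) + (E SR_ε(c) − c)·(⌊c⌋ + ⌈c⌉ − 2c)`. -/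
theorem srEps_sq_eq_frontier {F : Finset K} {ε c : K} (hε : 0 ≤ ε) (hc : InHull F c)
    (h0 : (0 : K) ∈ F) :
    srEpsE F ε c (fun z => (z - c) ^ 2)
      = srVar F c + (srEpsMean F ε c - c) * (dn F c + up F c - 2 * c) := by
  unfold srEpsMean
  rw [srEpsE_eq_stepQ hε hc h0, srEpsE_eq_stepQ hε hc h0]
  exact stepQ_sq_eq_frontier F (qAway ε) hc

/-- The bias of `SR_ε(c)` has the sign of `c` STRICTLY off the grid: `0 < sign(c)·(E SR_ε(c) − c)`
(`0 < ε`, `0 ∈ F`, `⌊c⌋ < ⌈c⌉`). -/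
theorem sgn_mul_srEps_bias_pos {F : Finset K} {ε c : K} (hε : 0 < ε) (hc : InHull F c)
    (h0 : (0 : K) ∈ F) (hdu : dn F c < up F c) : 0 < sgn c * (srEpsMean F ε c - c) := by
  obtain ⟨hd, hu, hp⟩ := dn_up_pUp_of_inHull hc
  obtain ⟨spos, sneg⟩ := sign_of_cell hc h0 hdu
  have hdc := dn_le_of_inHull hc
  have hcu := le_up_of_inHull hc
  have hcF : c ≠ dn F c ∧ c ≠ up F c := by
    constructor <;> intro h
    · have : c ∈ F := h ▸ dn_mem ⟨0, h0⟩ c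
      rw [hd, hu, roundDown_eq_self_of_mem this, roundUp_eq_self_of_mem this] at hdu
      exact lt_irrefl _ hdu
    · have : c ∈ F := h ▸ up_mem ⟨0, h0⟩ c
      rw [hd, hu, roundDown_eq_self_of_mem this, roundUp_eq_self_of_mem this] at hdu
      exact lt_irrefl _ hdu
  have hdlt : dn F c < c := lt_of_le_of_ne hdc (Ne.symm hcF.1)
  have hult : c < up F c := lt_of_le_of_ne hcu hcF.2
  rw [srEpsMean_sub_eq, ← hd, ← hu]
  obtain ⟨r1, r2⟩ := eta_regimes F hε.le c
  split_ifs with h1 h2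
  · have hcneg := (r1 h1).1
    rw [show sgn c = -1 by simp [sgn, hcneg, not_lt.mpr hcneg.le]]
    linarith
  · have hcpos := (r2 h2).1
    rw [show sgn c = 1 by simp [sgn, hcpos]]
    linarith
  · by_cases hd0 : 0 ≤ dn F c
    · rw [show sgn c = 1 by simp [sgn, spos hd0]]
      nlinarith
    · push Not at hd0
      have hcneg := sneg hd0
      rw [show sgn c = -1 by simp [sgn, hcneg, not_lt.mpr hcneg.le]]
      nlinarith

/-- **`SR_ε` is MSE-optimal for its own bias iff `|c|` lies in the upper half of its cell**:
`E(SR_ε(c) − c)² = budgetMSE F c |bias|` iff `0 ≤ sign(c)·(2c − ⌊c⌋ − ⌈c⌉)`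
(`0 < ε`, hull point off the grid, `0 ∈ F`). -/
theorem srEps_optimal_iff {F : Finset K} {ε c : K} (hε : 0 < ε) (hc : InHull F c)
    (h0 : (0 : K) ∈ F) (hdu : dn F c < up F c) :
    srEpsE F ε c (fun z => (z - c) ^ 2) = budgetMSE F c |srEpsMean F ε c - c|
      ↔ 0 ≤ sgn c * (2 * c - dn F c - up F c) := by
  have hq := LimitedBits.pUpQ_mem F (qAway_mem hε.le) c
  have key := stepQ_sq_eq_budget_iff F (qAway ε) hc hq.1 hq.2
  unfold srEpsMean
  rw [srEpsE_eq_stepQ hε.le hc h0, srEpsE_eq_stepQ hε.le hc h0, key]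
  have hb := sgn_mul_srEps_bias_pos hε hc h0 hdu
  unfold srEpsMean at hb
  rw [srEpsE_eq_stepQ hε.le hc h0] at hb
  have hs : sgn c * sgn c = 1 := by
    rcases lt_trichotomy c 0 with h | h | h
    · simp [sgn, h, not_lt.mpr h.le]
    · exfalso; subst h; simp [sgn] at hb
    · simp [sgn, h]
  rw [mul_nonpos_iff_of_sign hs hb]
  constructor <;> intro h <;> nlinarith

omit [IsStrictOrderedRing K] in
/-- Signed-`SR_ε` is the two-point cell law with down-probability `p̂_ε` (venture candidates). -/
theorem signedSrEpsE_eq_stepQ {F : Finset K} (ε v : K) {c : K} (hc : InHull F c) (f : K → K) :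
    signedSrEpsE F ε v c f
      = LimitedBits.stepQ F (constQ F c (1 - pEpsHat F ε v c)) c f := by
  obtain ⟨hd, hu, _⟩ := dn_up_pUp_of_inHull hc
  rw [stepQ_constQ, signedSrEpsE, ← hd, ← hu]; ring

/-- The bias of signed-`SR_ε(c)` has the sign of `−v` STRICTLY off the grid (`0 < ε`, `v ≠ 0`). -/
theorem sgn_mul_signedSrEps_bias_neg {F : Finset K} {ε v c : K} (hε : 0 < ε) (hv : v ≠ 0)
    (hc : InHull F c) (h0 : (0 : K) ∈ F) (hdu : dn F c < up F c) :
    sgn v * (signedSrEpsMean F ε v c - c) < 0 := by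
  obtain ⟨hd, hu, hp⟩ := dn_up_pUp_of_inHull hc
  have hdc := dn_le_of_inHull hc
  have hcu := le_up_of_inHull hc
  have hcF : c ≠ dn F c ∧ c ≠ up F c := by
    constructor <;> intro h
    · have : c ∈ F := h ▸ dn_mem ⟨0, h0⟩ c
      rw [hd, hu, roundDown_eq_self_of_mem this, roundUp_eq_self_of_mem this] at hdu
      exact lt_irrefl _ hdu
    · have : c ∈ F := h ▸ up_mem ⟨0, h0⟩ c
      rw [hd, hu, roundDown_eq_self_of_mem this, roundUp_eq_self_of_mem this] at hdu
      exact lt_irrefl _ hdu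
  have hdlt : dn F c < c := lt_of_le_of_ne hdc (Ne.symm hcF.1)
  have hult : c < up F c := lt_of_le_of_ne hcu hcF.2
  have hθ0 : 0 ≤ probUp F c := probUp_nonneg F c
  have hθ1 : probUp F c ≤ 1 := probUp_le_one F c
  rw [signedSrEpsMean_sub_eq, ← hd, ← hu]
  rcases lt_or_gt_of_ne hv with hvn | hvp
  · have hs : sgn v = -1 := by simp [sgn, hvn, not_lt.mpr hvn.le]
    rw [hs]
    split_ifs with h1 h2
    · exfalso; unfold etaHat at h1; rw [hs] at h1; nlinarith
    · linarith
    · nlinarith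
  · have hs : sgn v = 1 := by simp [sgn, hvp]
    rw [hs]
    split_ifs with h1 h2
    · linarith
    · exfalso; unfold etaHat at h2; rw [hs] at h2; nlinarith
    · nlinarith

/-- **Signed-`SR_ε` is MSE-optimal for its own bias iff `c` lies in the half-cell on the side it is
pushed to**: `E(signed-SR_ε(c) − c)² = budgetMSE F c |bias|` iff `0 ≤ sign(v)·(⌊c⌋ + ⌈c⌉ − 2c)`
(`0 < ε`, `v ≠ 0`, hull point off the grid, `0 ∈ F`). -/
theorem signedSrEps_optimal_iff {F : Finset K} {ε v c : K} (hε : 0 < ε) (hv : v ≠ 0)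
    (hc : InHull F c) (h0 : (0 : K) ∈ F) (hdu : dn F c < up F c) :
    signedSrEpsE F ε v c (fun z => (z - c) ^ 2) = budgetMSE F c |signedSrEpsMean F ε v c - c|
      ↔ 0 ≤ sgn v * (dn F c + up F c - 2 * c) := by
  set π := 1 - pEpsHat F ε v c with hπ
  have hπ0 : 0 ≤ π := by
    rw [hπ]; unfold pEpsHat clip01
    linarith [max_le (zero_le_one (α := K)) (min_le_right (etaHat F ε v c) 1)]
  have hπ1 : π ≤ 1 := by
    rw [hπ]; unfold pEpsHat clip01
    linarith [le_max_left (0 : K) (min (etaHat F ε v c) 1)]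
  have key := twoPoint_budget_iff hc hπ0 hπ1
  have hmean : signedSrEpsMean F ε v c - c = π * up F c + (1 - π) * dn F c - c := by
    unfold signedSrEpsMean; rw [signedSrEpsE_eq_stepQ ε v hc, stepQ_constQ]
  have hsq : signedSrEpsE F ε v c (fun z => (z - c) ^ 2)
      = π * (up F c - c) ^ 2 + (1 - π) * (dn F c - c) ^ 2 := by
    rw [signedSrEpsE_eq_stepQ ε v hc, stepQ_constQ]
  rw [hsq, hmean, key, ← hmean]
  have hb := sgn_mul_signedSrEps_bias_neg hε hv hc h0 hdu
  have hs : (-sgn v) * (-sgn v) = 1 := by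
    rcases lt_or_gt_of_ne hv with h | h
    · simp [sgn, h, not_lt.mpr h.le]
    · simp [sgn, h]
  rw [mul_nonpos_iff_of_sign hs (by linarith)]
  constructor <;> intro h <;> linarith

end Generic

/-! ### FP4 (E2M1) witness, kernel-checked -/

namespace FP4

open Literature.ComputerArithmetic.XiaEtAl2022 in
/-- E2M1, `ε = 1/4`, cell `[1, 3/2]`.  At `c = 9/8` (lower half): `p_ε = 1/2`, `E SR_ε = 5/4` (bias `1/8`),
MSE `5/64`, but the optimum for bias `1/8` is `1/64` (`budgetMSE`), so `SR_ε` wastes `1/16`.  At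
`c = 11/8` (upper half): `p_ε = 0`, `E SR_ε = 3/2` (bias `1/8`), MSE `1/64 = budgetMSE`: optimal. -/
theorem e2m1_srEps_witness :
    pEps e2m1 (1/4 : ℚ) (9/8) = 1/2 ∧ srEpsMean e2m1 (1/4 : ℚ) (9/8) = 5/4
    ∧ srEpsE e2m1 (1/4 : ℚ) (9/8) (fun z => (z - 9/8) ^ 2) = 5/64
    ∧ budgetMSE e2m1 (9/8 : ℚ) (1/8) = 1/64
    ∧ pEps e2m1 (1/4 : ℚ) (11/8) = 0 ∧ srEpsMean e2m1 (1/4 : ℚ) (11/8) = 3/2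
    ∧ srEpsE e2m1 (1/4 : ℚ) (11/8) (fun z => (z - 11/8) ^ 2) = 1/64
    ∧ budgetMSE e2m1 (11/8 : ℚ) (1/8) = 1/64 := by
  refine ⟨?_, ?_, ?_, ?_, ?_, ?_, ?_, ?_⟩ <;> decide +kernel

end FP4

end Summit.Ventures.CertifiedArithmetic.LowPrec.SR
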